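import Summits.QuantumAdvantage.QuantumAdvantage.Theorems.CubicForrelationNearExactIsExactTwelveLevelSixRigidPack224

/-!
# Crux `CubicForrelation.NearExactIsExact` (stmt-QuantumAdvantage-14043) — n = 12, level ≥ 6: the residual off the 9-flat at off-flat energy
  `≤ 224` (at `932/1024`: `Σ e² ≤ 736`), part A1: three round-1 bad cosets

Certificate seat `b2b-cforr-cert` (gen 18).  HONEST FRAMING: a lemma (standard axioms) for the level-`≥ 6` branch of "is `932/1024` attained at `n = 12`
with both sides at level ≥ 6?" (total budget `Σ e² ≤ 736`, off-flat energy `≤ 224`); finite-slice bookkeeping, NOT summit progress.  It is `tw18_off_flat_three_223` (gen 18)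
with `1` more unit of energy: up to `56` exceptional points of cost `4` fit, or fewer with one or two points of larger cost (`e = ±4`, or one `e = ±6`); a point
with `8 ∤ e` outside the three bad cosets is excluded by round 2 (`7`-flat parity: it would bring `8` points of cost `16`), and
`tw18_rigid_pack224` makes the configuration RIGID: `Ω = {y ∉ Z : 8 ∤ e(y)}` lies in the three cosets, `#Ω ≤ 56`, `e² = 4` on `Ω` except at
most two points, energy `≥ 192`.

References: J. Ax (1964) / R. J. McEliece (1972); MacWilliams–Sloane (1977) Ch. 13 §3.  Axioms: the standard three.
-/



set_option linter.dupNamespace false -- D-0017: single-problem summit ⇒ `QuantumAdvantage.QuantumAdvantage` by design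

noncomputable section

namespace Summit.QuantumAdvantage.QuantumAdvantage.Theorems.CubicForrelation.NearExactIsExact

open Finset
open Literature.Computability.QuantumComplexity
open Literature.Computability.QuantumComplexity.BuzetChailloux (bxor zeroVec bxor_bxor_cancel_left bxor_zeroVec zeroVec_bxor bxor_comm
  bxor_self)
open Literature.Computability.QuantumComplexity.DerivativeWalsh (W)

/-! ### The residual off the 9-flat, energy `≤ 224`: three round-1 bad cosets -/

/-- **Off the flat at energy `≤ 224` with THREE round-1 bad cosets: the RIGID exception (two exceptional points allowed).**  See the module
docstring (part A1 of `tw18_off_flat_le224`). [this work] -/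
theorem tw18_off_flat_three_224 (f g : (Fin (6 + 6) → Bool) → Bool) (hf : IsDegLeFun 3 f) (hg : IsDegLeFun 3 g)
    (u'' : (Fin (6 + 6) → Bool) → ℤ) (hu'' : ∀ x, W (fun y => signOf (g y)) x = (2 : ℝ) ^ 6 * (u'' x : ℝ))
    (V₀ : Finset (Fin (6 + 6) → Bool)) (xZ : Fin (6 + 6) → Bool) (h0 : zeroVec ∈ V₀)
    (hadd : ∀ a ∈ V₀, ∀ b ∈ V₀, bxor a b ∈ V₀) (hcardV9 : #V₀ = 2 ^ 9)
    (hS : (univ.filter fun x : Fin (6 + 6) → Bool => ¬ Odd (u'' x)) = V₀.image (bxor xZ))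
    (hoff_le : ∑ x ∈ univ.filter (fun x => x ∉ (univ.filter fun x : Fin (6 + 6) → Bool => ¬ Odd (u'' x))),
      (u'' x - sZ (f x)) ^ 2 ≤ 224)
    (p : Fin (6 + 6) → Bool) (hp : p ∉ (univ.filter fun x : Fin (6 + 6) → Bool => ¬ Odd (u'' x)))
    (hpodd : Odd ((u'' p - sZ (f p)) / 2))
    (z : Fin (6 + 6) → Bool) (hz : z ∉ (univ.filter fun x : Fin (6 + 6) → Bool => ¬ Odd (u'' x)))
    (hzC : z ∉ V₀.image (bxor p)) (hzodd : Odd ((u'' z - sZ (f z)) / 2))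
    (y : Fin (6 + 6) → Bool) (hy : y ∉ (univ.filter fun x : Fin (6 + 6) → Bool => ¬ Odd (u'' x)))
    (hyp : y ∉ V₀.image (bxor p)) (hyz : y ∉ V₀.image (bxor z)) (hyodd : Odd ((u'' y - sZ (f y)) / 2)) :
    (∃ y₁ y₂ y₃ : Fin (6 + 6) → Bool, y₁ ∉ (univ.filter fun x : Fin (6 + 6) → Bool => ¬ Odd (u'' x)) ∧
      y₂ ∉ (univ.filter fun x : Fin (6 + 6) → Bool => ¬ Odd (u'' x)) ∧ y₃ ∉ (univ.filter fun x : Fin (6 + 6) → Bool => ¬ Odd (u'' x)) ∧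
      y₂ ∉ V₀.image (bxor y₁) ∧ y₃ ∉ V₀.image (bxor y₁) ∧ y₃ ∉ V₀.image (bxor y₂) ∧
      (∀ ω ∈ univ.filter (fun ω => ω ∉ (univ.filter fun x : Fin (6 + 6) → Bool => ¬ Odd (u'' x)) ∧ ¬ (8 : ℤ) ∣ u'' ω - sZ (f ω)),
        ω ∈ V₀.image (bxor y₁) ∨ ω ∈ V₀.image (bxor y₂) ∨ ω ∈ V₀.image (bxor y₃)) ∧
      #(univ.filter (fun ω => ω ∉ (univ.filter fun x : Fin (6 + 6) → Bool => ¬ Odd (u'' x)) ∧ ¬ (8 : ℤ) ∣ u'' ω - sZ (f ω))) ≤ 56 ∧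
      (∃ ω₄ ω₄' : Fin (6 + 6) → Bool, ∀ ω ∈ univ.filter (fun ω => ω ∉ (univ.filter fun x : Fin (6 + 6) → Bool => ¬ Odd (u'' x)) ∧
        ¬ (8 : ℤ) ∣ u'' ω - sZ (f ω)), (u'' ω - sZ (f ω)) ^ 2 = 4 ∨ ω = ω₄ ∨ ω = ω₄') ∧
      192 ≤ ∑ x ∈ univ.filter (fun x => x ∉ (univ.filter fun x : Fin (6 + 6) → Bool => ¬ Odd (u'' x))), (u'' x - sZ (f x)) ^ 2) := by
  classical
  set Z := univ.filter (fun x : Fin (6 + 6) → Bool => ¬ Odd (u'' x)) with hZdef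
  have hmemZ : ∀ x, x ∈ Z ↔ ¬ Odd (u'' x) := fun x => by simp [hZdef]
  set e : (Fin (6 + 6) → Bool) → ℤ := fun x => u'' x - sZ (f x) with hedef
  show (∃ y₁ y₂ y₃ : Fin (6 + 6) → Bool, y₁ ∉ Z ∧ y₂ ∉ Z ∧ y₃ ∉ Z ∧
      y₂ ∉ V₀.image (bxor y₁) ∧ y₃ ∉ V₀.image (bxor y₁) ∧ y₃ ∉ V₀.image (bxor y₂) ∧
      (∀ ω ∈ univ.filter (fun ω => ω ∉ Z ∧ ¬ (8 : ℤ) ∣ e ω), ω ∈ V₀.image (bxor y₁) ∨ ω ∈ V₀.image (bxor y₂) ∨ ω ∈ V₀.image (bxor y₃)) ∧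
      #(univ.filter (fun ω => ω ∉ Z ∧ ¬ (8 : ℤ) ∣ e ω)) ≤ 56 ∧
      (∃ ω₄ ω₄' : Fin (6 + 6) → Bool, ∀ ω ∈ univ.filter (fun ω => ω ∉ Z ∧ ¬ (8 : ℤ) ∣ e ω), e ω ^ 2 = 4 ∨ ω = ω₄ ∨ ω = ω₄') ∧
      192 ≤ ∑ x ∈ univ.filter (fun x => x ∉ Z), e x ^ 2)
  change p ∉ Z at hp
  change Odd (e p / 2) at hpodd
  change z ∉ Z at hz
  change Odd (e z / 2) at hzodd
  change y ∉ Z at hy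
  change Odd (e y / 2) at hyodd
  have heeven : ∀ x, x ∉ Z → Even (e x) := by
    intro x hx
    have hodd : Odd (u'' x) := not_not.1 fun h => hx ((hmemZ x).2 h)
    rcases tp_sZ_cases (f x) with hs | hs <;> simp only [e] <;> rw [hs] <;>
      exact Int.even_sub.2 (iff_of_false (Int.not_even_iff_odd.2 hodd) (by decide))
  have hPV' : ∀ x, x ∉ Z → ∀ a ∈ V₀, bxor x a ∉ Z := fun x hx a ha => fl1_coset_out' hadd hS hx ha
  -- flat sums of `e`: `4 ∣` on 6-flats, `8 ∣` on 7-flats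
  have hflat6 : ∀ (b : Fin (6 + 6) → Bool) (a : Fin 6 → Fin (6 + 6) → Bool),
      (4 : ℤ) ∣ ∑ ε : Fin 6 → Bool, e (fun j => b j ^^ decide (Odd #(univ.filter fun i => ε i && a i j))) :=
    fun b a => tw15_e_flat6 f g hf hg u'' hu'' b a
  have hflat7 : ∀ (b : Fin (6 + 6) → Bool) (a : Fin 7 → Fin (6 + 6) → Bool),
      (8 : ℤ) ∣ ∑ ε : Fin 7 → Bool, e (fun j => b j ^^ decide (Odd #(univ.filter fun i => ε i && a i j))) :=
    fun b a => tw15_e_flat7 f g hf hg u'' hu'' b a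
  -- OFF-Z KILL, round 1: `4 ∣ e` off `Z`
  have hcos_out : ∀ p, p ∉ Z → ∀ b ∈ V₀.image (bxor p), b ∉ Z := by
    intro p hp b hb
    obtain ⟨v, hv, rfl⟩ := mem_image.1 hb
    exact hPV' p hp v hv
  have hoff_count : ∀ (T : Finset (Fin (6 + 6) → Bool)) (c : ℤ), (∀ x ∈ T, x ∉ Z) → (∀ x ∈ T, c ≤ e x ^ 2) →
      c * #T ≤ 224 := by
    intro T c hT hc
    calc c * #T = ∑ x ∈ T, c := by rw [sum_const, nsmul_eq_mul, mul_comm]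
      _ ≤ ∑ x ∈ T, e x ^ 2 := sum_le_sum hc
      _ ≤ ∑ x ∈ univ.filter (fun x => x ∉ Z), e x ^ 2 :=
          sum_le_sum_of_subset_of_nonneg (fun x hx => mem_filter.2 ⟨mem_univ _, hT x hx⟩) fun x _ _ => sq_nonneg _
      _ ≤ 224 := hoff_le
  have hxZ : xZ ∈ Z := by rw [hS]; exact mem_image.2 ⟨zeroVec, h0, bxor_zeroVec xZ⟩
  have hPV : ∀ x, x ∈ Z → ∀ a ∈ V₀, bxor x a ∈ Z := fun x hx a ha => fl1_coset_vadd hadd hS hx ha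
  have hp2 : ∀ y, y ∉ Z → e y = 2 * (e y / 2) := fun y hy =>
    (Int.mul_ediv_cancel' (even_iff_two_dvd.1 (heeven y hy))).symm
  have hcost4 : ∀ x, x ∉ Z → Odd (e x / 2) → 4 ≤ e x ^ 2 := by
    intro x hx hodd
    have h0' := Int.odd_iff.1 hodd
    have h2 := hp2 x hx
    have : e x ≤ -2 ∨ 2 ≤ e x := by omega
    have := tp_sq_ge (k := 2) (by norm_num) this
    linarith
  -- round 1a: in a coset `p ⊕ V₀` (`p ∉ Z`) `e/2` is even, or odd at `≥ 16` points (6-flat parity + Reed–Muller on the abstract flat)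
  have hdich : ∀ p, p ∉ Z → (∀ x ∈ V₀.image (bxor p), Even (e x / 2)) ∨
      16 ≤ #((V₀.image (bxor p)).filter fun x => Odd (e x / 2)) := by
    intro p hp
    rcases ws_erm_round V₀ h0 hadd hcardV9 p (fun y => e y / 2) 5 (fun b hb a ha => by
        have hpts : ∀ ε : Fin (5 + 1) → Bool, (fun j => b j ^^ decide (Odd #(univ.filter fun i => ε i && a i j))) ∉ Z :=
          fun ε => ws_flatPt_mem V₀ h0 (· ∉ Z) hPV' (5 + 1) b (hcos_out p hp b hb) a ha ε
        have h4 := hflat6 b a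
        rw [sum_congr rfl fun ε _ => hp2 _ (hpts ε), ← mul_sum] at h4
        obtain ⟨k, hk⟩ := h4
        exact ⟨k, by linarith⟩) with hev | hbig
    · exact Or.inl hev
    · right; norm_num at hbig; omega
  have hbad_of_odd : ∀ p, p ∉ Z → Odd (e p / 2) → 16 ≤ #((V₀.image (bxor p)).filter fun x => Odd (e x / 2)) := by
    intro p hp hpodd
    refine (hdich p hp).resolve_left fun h => ?_
    exact (Int.not_even_iff_odd.2 hpodd) (h p (mem_image.2 ⟨zeroVec, h0, bxor_zeroVec p⟩))
  -- a nonzero even value costs `≥ 4`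
  have hcost4' : ∀ x, x ∉ Z → e x ≠ 0 → 4 ≤ e x ^ 2 := by
    intro x hx hne
    obtain ⟨k, hk⟩ := heeven x hx
    have hk0 : k ≠ 0 := by rintro rfl; exact hne (by rw [hk]; ring)
    have : e x ≤ -2 ∨ 2 ≤ e x := by omega
    have := tp_sq_ge (k := 2) (by norm_num) this
    linarith
  have hsymm : ∀ q x : Fin (6 + 6) → Bool, x ∈ V₀.image (bxor q) → q ∈ V₀.image (bxor x) := by
    intro q x hx
    obtain ⟨v, hv, hvx⟩ := mem_image.1 hx
    exact mem_image.2 ⟨v, hv, by rw [← hvx, iw_bxor_assoc, bxor_self, bxor_zeroVec]⟩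
  have hchain : ∀ q x w : Fin (6 + 6) → Bool, x ∈ V₀.image (bxor q) → w ∈ V₀.image (bxor x) → w ∈ V₀.image (bxor q) := by
    intro q x w hx hw
    obtain ⟨v, hv, hvx⟩ := mem_image.1 hx
    obtain ⟨v', hv', hv'w⟩ := mem_image.1 hw
    exact mem_image.2 ⟨bxor v v', hadd v hv v' hv', by rw [← hv'w, ← hvx, iw_bxor_assoc]⟩
  -- round 2 dichotomy ON A COSET where `4 ∣ e`: `e/4` is even there, or odd at `≥ 8` points (7-flat parity + Reed–Muller)
  have hcost16 : ∀ x, x ∉ Z → (4 : ℤ) ∣ e x → Odd (e x / 4) → 16 ≤ e x ^ 2 := by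
    intro x _ h4 hodd
    have h0' := Int.odd_iff.1 hodd
    have h2 := (Int.mul_ediv_cancel' h4).symm
    have : e x ≤ -4 ∨ 4 ≤ e x := by omega
    have := tp_sq_ge (k := 4) (by norm_num) this
    linarith
  have hdich4q : ∀ q, q ∉ Z → (∀ x ∈ V₀.image (bxor q), (4 : ℤ) ∣ e x) →
      (∀ x ∈ V₀.image (bxor q), Even (e x / 4)) ∨ 8 ≤ #((V₀.image (bxor q)).filter fun x => Odd (e x / 4)) := by
    intro q hq h4
    have hPVq : ∀ x, x ∈ V₀.image (bxor q) → ∀ a ∈ V₀, bxor x a ∈ V₀.image (bxor q) :=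
      fun x hx a ha => fl1_coset_vadd hadd rfl hx ha
    rcases ws_erm_round V₀ h0 hadd hcardV9 q (fun y => e y / 4) 6 (fun b hb a ha => by
        have hpts : ∀ ε : Fin (6 + 1) → Bool, (fun j => b j ^^ decide (Odd #(univ.filter fun i => ε i && a i j))) ∈ V₀.image (bxor q) :=
          fun ε => ws_flatPt_mem V₀ h0 (· ∈ V₀.image (bxor q)) hPVq (6 + 1) b hb a ha ε
        have h8 := hflat7 b a
        rw [sum_congr rfl fun ε _ => (Int.mul_ediv_cancel' (h4 _ (hpts ε))).symm, ← mul_sum] at h8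
        obtain ⟨k, hk⟩ := h8
        exact ⟨k, by linarith⟩) with hev | hbig
    · exact Or.inl hev
    · right; norm_num at hbig; omega
  have hbad := hbad_of_odd p hp hpodd
  have hCz := hbad_of_odd z hz hzodd
  have hpCz : p ∉ V₀.image (bxor z) := fun h => hzC (hsymm z p h)
  set Bp := (V₀.image (bxor p)).filter (fun x => Odd (e x / 2)) with hBp
  set Bz := (V₀.image (bxor z)).filter (fun x => Odd (e x / 2)) with hBz
  have hdisj : Disjoint Bp Bz := by
    rw [disjoint_left]
    intro x hxp hxz
    exact hzC (hchain p x z (mem_filter.1 hxp).1 (hsymm z x (mem_filter.1 hxz).1))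
  -- energy: the two bad sets already cost `128`
  have hBsum : (128 : ℤ) ≤ ∑ x ∈ Bp ∪ Bz, e x ^ 2 := by
    have h1 : ∑ x ∈ Bp ∪ Bz, (4 : ℤ) ≤ ∑ x ∈ Bp ∪ Bz, e x ^ 2 := sum_le_sum fun x hx => by
      rcases mem_union.1 hx with h | h
      · exact hcost4 x (hcos_out p hp x (mem_filter.1 h).1) (mem_filter.1 h).2
      · exact hcost4 x (hcos_out z hz x (mem_filter.1 h).1) (mem_filter.1 h).2
    rw [sum_const, nsmul_eq_mul, card_union_of_disjoint hdisj] at h1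
    push_cast at h1
    have h16p : (16 : ℤ) ≤ #Bp := by exact_mod_cast hbad
    have h16z : (16 : ℤ) ≤ #Bz := by exact_mod_cast hCz
    linarith
  have hBsub : Bp ∪ Bz ⊆ univ.filter (fun x => x ∉ Z) := by
    intro x hx
    rcases mem_union.1 hx with h | h
    · exact mem_filter.2 ⟨mem_univ _, hcos_out p hp x (mem_filter.1 h).1⟩
    · exact mem_filter.2 ⟨mem_univ _, hcos_out z hz x (mem_filter.1 h).1⟩
  have hBle : ∑ x ∈ Bp ∪ Bz, e x ^ 2 ≤ ∑ x ∈ univ.filter (fun x => x ∉ Z), e x ^ 2 :=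
    sum_le_sum_of_subset_of_nonneg hBsub fun x _ _ => sq_nonneg _
  -- odd points are not multiples of `8`; `8 ∤ e` off `Z` means `e² = 4` or `e² ≥ 16`; `8 ∤ e` fails only at `e = 0` or `|e| ≥ 8`
  have hodd8 : ∀ x, x ∉ Z → Odd (e x / 2) → ¬ (8 : ℤ) ∣ e x := by
    intro x hx hxodd h8
    obtain ⟨m, hm⟩ := h8
    have h2 := hp2 x hx
    have : e x / 2 = 4 * m := by omega
    rw [this] at hxodd
    exact (Int.not_even_iff_odd.2 hxodd) ⟨2 * m, by ring⟩
  have hval8 : ∀ x, x ∉ Z → ¬ (8 : ℤ) ∣ e x → e x ^ 2 = 4 ∨ 16 ≤ e x ^ 2 := by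
    intro x hx h8
    obtain ⟨j, hj⟩ := heeven x hx
    have hj0 : j ≠ 0 := by rintro rfl; exact h8 ⟨0, by rw [hj]; ring⟩
    rcases lt_trichotomy j 0 with h | h | h
    · by_cases h1 : j = -1
      · left; rw [hj, h1]; norm_num
      · right; have : j ≤ -2 := by omega
        rw [hj]; nlinarith
    · exact absurd h hj0
    · by_cases h1 : j = 1
      · left; rw [hj, h1]; norm_num
      · right; have : 2 ≤ j := by omega
        rw [hj]; nlinarith
  have hval4 : ∀ x, x ∉ Z → ¬ Odd (e x / 2) → e x = 0 ∨ 16 ≤ e x ^ 2 := by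
    intro x hx hnodd
    obtain ⟨j, hj⟩ := Int.not_odd_iff_even.1 hnodd
    have h2 := hp2 x hx
    have he : e x = 4 * j := by rw [h2, hj]; ring
    by_cases hj0 : j = 0
    · left; rw [he, hj0]; ring
    · right
      have : j ≤ -1 ∨ 1 ≤ j := by omega
      have := tp_sq_ge (k := 1) (by norm_num) this
      rw [he]; nlinarith
  have hBA : ∀ (q : Fin (6 + 6) → Bool), q ∉ Z → (V₀.image (bxor q)).filter (fun x => Odd (e x / 2)) ⊆
      (V₀.image (bxor q)).filter (fun y => ¬ (8 : ℤ) ∣ e y) := fun q hq x hx =>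
    mem_filter.2 ⟨(mem_filter.1 hx).1, hodd8 x (hcos_out q hq x (mem_filter.1 hx).1) (mem_filter.1 hx).2⟩
  -- the rigid packaging: `≥ 48` exceptional points inside three cosets exhaust the energy up to `16`
  have hrigid : ∀ (U : Finset (Fin (6 + 6) → Bool)) (y₃ : Fin (6 + 6) → Bool), y₃ ∉ Z → y₃ ∉ V₀.image (bxor p) →
      y₃ ∉ V₀.image (bxor z) → (∀ x ∈ U, x ∉ Z) → (∀ x ∈ U, ¬ (8 : ℤ) ∣ e x) → 48 ≤ #U →
      (∀ x ∈ U, x ∈ V₀.image (bxor p) ∨ x ∈ V₀.image (bxor z) ∨ x ∈ V₀.image (bxor y₃)) →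
      (∀ x, x ∉ Z → x ∉ U → e x = 0 ∨ 16 ≤ e x ^ 2) →
      (∀ x, x ∉ Z → ¬ (x ∈ V₀.image (bxor p) ∨ x ∈ V₀.image (bxor z) ∨ x ∈ V₀.image (bxor y₃)) → ¬ (8 : ℤ) ∣ e x →
        ∃ T : Finset (Fin (6 + 6) → Bool), 8 ≤ #T ∧
          (∀ w ∈ T, w ∉ Z ∧ ¬ (w ∈ V₀.image (bxor p) ∨ w ∈ V₀.image (bxor z) ∨ w ∈ V₀.image (bxor y₃))) ∧ ∀ w ∈ T, 16 ≤ e w ^ 2) →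
      (∃ y₁ y₂ y₃ : Fin (6 + 6) → Bool, y₁ ∉ Z ∧ y₂ ∉ Z ∧ y₃ ∉ Z ∧
        y₂ ∉ V₀.image (bxor y₁) ∧ y₃ ∉ V₀.image (bxor y₁) ∧ y₃ ∉ V₀.image (bxor y₂) ∧
        (∀ ω ∈ univ.filter (fun ω => ω ∉ Z ∧ ¬ (8 : ℤ) ∣ e ω),
          ω ∈ V₀.image (bxor y₁) ∨ ω ∈ V₀.image (bxor y₂) ∨ ω ∈ V₀.image (bxor y₃)) ∧
        #(univ.filter (fun ω => ω ∉ Z ∧ ¬ (8 : ℤ) ∣ e ω)) ≤ 56 ∧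
        (∃ ω₄ ω₄' : Fin (6 + 6) → Bool, ∀ ω ∈ univ.filter (fun ω => ω ∉ Z ∧ ¬ (8 : ℤ) ∣ e ω), e ω ^ 2 = 4 ∨ ω = ω₄ ∨ ω = ω₄') ∧
        192 ≤ ∑ x ∈ univ.filter (fun x => x ∉ Z), e x ^ 2) := by
    intro U y₃ hy₃ hy₃p hy₃z hUZ hU8 hU48 hUC hout hfar
    have hU4 : ∀ x ∈ U, e x ^ 2 = 4 ∨ 16 ≤ e x ^ 2 := fun x hx => hval8 x (hUZ x hx) (hU8 x hx)
    obtain ⟨h1, h2, h3, h4⟩ := tw18_rigid_pack224 e Z U (V₀.image (bxor p)) (V₀.image (bxor z)) (V₀.image (bxor y₃))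
      hUZ hU4 hU48 hUC hout hfar hoff_le
    exact ⟨p, z, y₃, hp, hz, hy₃, hzC, hy₃p, hy₃z, h1, h2, h3, h4⟩
  set Ap := (V₀.image (bxor p)).filter (fun y => ¬ (8 : ℤ) ∣ e y) with hAp
  set Az := (V₀.image (bxor z)).filter (fun y => ¬ (8 : ℤ) ∣ e y) with hAz
  have hBp' : #Bp ≤ #Ap := card_le_card (hBA p hp)
  have hBz' : #Bz ≤ #Az := card_le_card (hBA z hz)
  have hdisjA : Disjoint Ap Az := by
    rw [disjoint_left]
    intro x hxp hxz
    exact hzC (hchain p x z (mem_filter.1 hxp).1 (hsymm z x (mem_filter.1 hxz).1))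
  have hCy := hbad_of_odd y hy hyodd
  set By := (V₀.image (bxor y)).filter (fun x => Odd (e x / 2)) with hBy
  set Ay := (V₀.image (bxor y)).filter (fun w => ¬ (8 : ℤ) ∣ e w) with hAy
  have hBy' : #By ≤ #Ay := card_le_card (hBA y hy)
  have hdisj3 : Disjoint (Bp ∪ Bz) By := by
    rw [disjoint_left]
    intro x hx hxy
    rcases mem_union.1 hx with hxp | hxz
    · exact hyp (hchain p x y (mem_filter.1 hxp).1 (hsymm y x (mem_filter.1 hxy).1))
    · exact hyz (hchain z x y (mem_filter.1 hxz).1 (hsymm y x (mem_filter.1 hxy).1))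
  have hdisjA3 : Disjoint (Ap ∪ Az) Ay := by
    rw [disjoint_left]
    intro x hx hxy
    rcases mem_union.1 hx with hxp | hxz
    · exact hyp (hchain p x y (mem_filter.1 hxp).1 (hsymm y x (mem_filter.1 hxy).1))
    · exact hyz (hchain z x y (mem_filter.1 hxz).1 (hsymm y x (mem_filter.1 hxy).1))
  -- no fourth bad coset: it would cost `64` on top of `192`
  have hB3sub : (Bp ∪ Bz) ∪ By ⊆ univ.filter (fun x => x ∉ Z) := by
    intro x hx
    rcases mem_union.1 hx with h | h
    · exact hBsub h
    · exact mem_filter.2 ⟨mem_univ _, hcos_out y hy x (mem_filter.1 h).1⟩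
  have hB3cost : ∀ x ∈ (Bp ∪ Bz) ∪ By, (4 : ℤ) ≤ e x ^ 2 := by
    intro x hx
    rcases mem_union.1 hx with h | h
    · rcases mem_union.1 h with h' | h'
      · exact hcost4 x (hcos_out p hp x (mem_filter.1 h').1) (mem_filter.1 h').2
      · exact hcost4 x (hcos_out z hz x (mem_filter.1 h').1) (mem_filter.1 h').2
    · exact hcost4 x (hcos_out y hy x (mem_filter.1 h).1) (mem_filter.1 h).2
  have hno4 : ∀ w, w ∉ Z → w ∉ V₀.image (bxor p) → w ∉ V₀.image (bxor z) → w ∉ V₀.image (bxor y) → ¬ Odd (e w / 2) := by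
    intro w hw hwp hwz hwy hwodd
    set Bw := (V₀.image (bxor w)).filter (fun x => Odd (e x / 2)) with hBw
    have hCw := hbad_of_odd w hw hwodd
    have hdisj4 : Disjoint ((Bp ∪ Bz) ∪ By) Bw := by
      rw [disjoint_left]
      intro x hx hxw
      rcases mem_union.1 hx with h | h
      · rcases mem_union.1 h with h' | h'
        · exact hwp (hchain p x w (mem_filter.1 h').1 (hsymm w x (mem_filter.1 hxw).1))
        · exact hwz (hchain z x w (mem_filter.1 h').1 (hsymm w x (mem_filter.1 hxw).1))
      · exact hwy (hchain y x w (mem_filter.1 h).1 (hsymm w x (mem_filter.1 hxw).1))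
    have hsub4 : ((Bp ∪ Bz) ∪ By) ∪ Bw ⊆ univ.filter (fun x => x ∉ Z) := by
      intro x hx
      rcases mem_union.1 hx with h | h
      · exact hB3sub h
      · exact mem_filter.2 ⟨mem_univ _, hcos_out w hw x (mem_filter.1 h).1⟩
    have h1 : ∑ x ∈ ((Bp ∪ Bz) ∪ By) ∪ Bw, (4 : ℤ) ≤ ∑ x ∈ ((Bp ∪ Bz) ∪ By) ∪ Bw, e x ^ 2 := sum_le_sum fun x hx => by
      rcases mem_union.1 hx with h | h
      · exact hB3cost x h
      · exact hcost4 x (hcos_out w hw x (mem_filter.1 h).1) (mem_filter.1 h).2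
    rw [sum_const, nsmul_eq_mul, card_union_of_disjoint hdisj4, card_union_of_disjoint hdisj3, card_union_of_disjoint hdisj] at h1
    push_cast at h1
    have h2 := sum_le_sum_of_subset_of_nonneg hsub4 (f := fun x => e x ^ 2) fun x _ _ => sq_nonneg _
    have h16p : (16 : ℤ) ≤ #Bp := by exact_mod_cast hbad
    have h16z : (16 : ℤ) ≤ #Bz := by exact_mod_cast hCz
    have h16y : (16 : ℤ) ≤ #By := by exact_mod_cast hCy
    have h16w : (16 : ℤ) ≤ #Bw := by exact_mod_cast hCw
    linarith
  -- far points (outside the three bad cosets) with `8 ∤ e`: round 2 on their coset (where `4 ∣ e`) yields `8` points of cost `16`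
  have hfar : ∀ x, x ∉ Z → ¬ (x ∈ V₀.image (bxor p) ∨ x ∈ V₀.image (bxor z) ∨ x ∈ V₀.image (bxor y)) → ¬ (8 : ℤ) ∣ e x →
      ∃ T : Finset (Fin (6 + 6) → Bool), 8 ≤ #T ∧
        (∀ w ∈ T, w ∉ Z ∧ ¬ (w ∈ V₀.image (bxor p) ∨ w ∈ V₀.image (bxor z) ∨ w ∈ V₀.image (bxor y))) ∧ ∀ w ∈ T, 16 ≤ e w ^ 2 := by
    intro x hxZ hxC hx8
    push Not at hxC
    have hfarw : ∀ w ∈ V₀.image (bxor x), w ∉ Z ∧ w ∉ V₀.image (bxor p) ∧ w ∉ V₀.image (bxor z) ∧ w ∉ V₀.image (bxor y) := by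
      intro w hw
      exact ⟨hcos_out x hxZ w hw, fun h => hxC.1 (hchain p w x h (hsymm x w hw)), fun h => hxC.2.1 (hchain z w x h (hsymm x w hw)),
        fun h => hxC.2.2 (hchain y w x h (hsymm x w hw))⟩
    have h4w : ∀ w ∈ V₀.image (bxor x), (4 : ℤ) ∣ e w := by
      intro w hw
      obtain ⟨hwZ, hwp, hwz, hwy⟩ := hfarw w hw
      obtain ⟨k, hk⟩ := Int.not_odd_iff_even.1 (hno4 w hwZ hwp hwz hwy)
      exact ⟨k, by rw [hp2 w hwZ, hk]; ring⟩
    rcases hdich4q x hxZ h4w with hev | hbig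
    · exfalso
      have hx0 : x ∈ V₀.image (bxor x) := mem_image.2 ⟨zeroVec, h0, bxor_zeroVec x⟩
      obtain ⟨k, hk⟩ := hev x hx0
      exact hx8 ⟨k, by rw [(Int.mul_ediv_cancel' (h4w x hx0)).symm, hk]; ring⟩
    · refine ⟨(V₀.image (bxor x)).filter (fun w => Odd (e w / 4)), hbig, fun w hw => ?_, fun w hw => ?_⟩
      · obtain ⟨hwZ, hwp, hwz, hwy⟩ := hfarw w (mem_filter.1 hw).1
        exact ⟨hwZ, fun h => h.elim hwp (fun h => h.elim hwz hwy)⟩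
      · have hw1 := (mem_filter.1 hw).1
        exact hcost16 w (hfarw w hw1).1 (h4w w hw1) (mem_filter.1 hw).2
  refine hrigid ((Ap ∪ Az) ∪ Ay) y hy hyp hyz (fun x hx => ?_) (fun x hx => ?_) ?_ (fun x hx => ?_) (fun x hxZ hxU => ?_) hfar
  · rcases mem_union.1 hx with h | h
    · rcases mem_union.1 h with h' | h'
      · exact hcos_out p hp x (mem_filter.1 h').1
      · exact hcos_out z hz x (mem_filter.1 h').1
    · exact hcos_out y hy x (mem_filter.1 h).1
  · rcases mem_union.1 hx with h | h
    · rcases mem_union.1 h with h' | h'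
      · exact (mem_filter.1 h').2
      · exact (mem_filter.1 h').2
    · exact (mem_filter.1 h).2
  · rw [card_union_of_disjoint hdisjA3, card_union_of_disjoint hdisjA]
    change 16 ≤ #Bp at hbad
    change 16 ≤ #Bz at hCz
    change 16 ≤ #By at hCy
    omega
  · rcases mem_union.1 hx with h | h
    · rcases mem_union.1 h with h' | h'
      · exact Or.inl (mem_filter.1 h').1
      · exact Or.inr (Or.inl (mem_filter.1 h').1)
    · exact Or.inr (Or.inr (mem_filter.1 h).1)
  · by_cases hxodd : Odd (e x / 2)
    · exfalso
      by_cases hxp : x ∈ V₀.image (bxor p)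
      · exact hxU (mem_union.2 (Or.inl (mem_union.2 (Or.inl (mem_filter.2 ⟨hxp, hodd8 x hxZ hxodd⟩)))))
      by_cases hxz : x ∈ V₀.image (bxor z)
      · exact hxU (mem_union.2 (Or.inl (mem_union.2 (Or.inr (mem_filter.2 ⟨hxz, hodd8 x hxZ hxodd⟩)))))
      by_cases hxy : x ∈ V₀.image (bxor y)
      · exact hxU (mem_union.2 (Or.inr (mem_filter.2 ⟨hxy, hodd8 x hxZ hxodd⟩)))
      exact hno4 x hxZ hxp hxz hxy hxodd
    · exact hval4 x hxZ hxodd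

end Summit.QuantumAdvantage.QuantumAdvantage.Theorems.CubicForrelation.NearExactIsExact

end
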